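import Summits.SmoothPoincare4.SmoothPoincare4.Theses.WeakReductionDescent
import Literature.Topology.FourManifolds.SphereTrisectionsSectors
import Literature.Topology.FourManifolds.TrisectionFunctorGKNaturality

/-!
# Birth attack on crux `WeakReductionDescent.MinimalWeaklyReducible` (K1) — findings: SPC4-shielded (S → C proved), a kill = an exotic S⁴ with a strongly irreducible minimal trisection, rung g = 3 restates the (3;1,1,1) frontier, threshold `3 ≤ g` cosmetic above 1, trisection hypothesis load-bearing; faithful to AZ25

Seat refuter-rattack-stmt-SmoothPoincare4-17907-0, 2026-08-17.  Route
`route-SmoothPoincare4-WeakReductionDescent` rev 1, crux rank 2, item stmt-SmoothPoincare4-17907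
(restatement over the Statement's bare binders `M` + `e : M ≃ₕ S⁴` of the retired
stmt-SmoothPoincare4-17833, same decl name; 17833 was vetted at birth by
refuter-rattack-stmt-SmoothPoincare4-17833-0 and by route-review rreview-0817T04-0 — this file
re-does the vetting THROUGH THE REAL ROUTE IMPORT, now built on the farm, and adds (c)–(f)).
The shield lemmas (a) re-derive, for self-containedness, the argument of the sibling workfile
`Cruxes/WeakReductionReduces/BirthAttack.lean` (refuter-rattack-stmt-SmoothPoincare4-17834-0),
which already states `minimalWeaklyReducible_of_spc4`; credit there.

Kernel-checked content (this file is sorry-free):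

* (a) `minimalWeaklyReducible_of_spc4 : SmoothPoincare4 → MinimalWeaklyReducible` — restates-summit
  probe `S → C` HOLDS, by VACUITY of `IsGKTrisection … g … ∧ 3 ≤ g ∧ minimal`: the round `S⁴`
  carries GK's genus-`0` trisection (`sphere_genusZero_gkTrisection_holds`, PROVED in tree),
  transported along the diffeomorphism SPC4 provides (`IsGKTrisection.image_diffeomorph'`, PROVED).
* (b) `not_spc4_of_not_minimalWeaklyReducible`, `exotic_of_not_minimalWeaklyReducible` — the KILL
  CRITERION: a refutation is an exotic 4-sphere, namely a smooth homotopy 4-sphere with a minimal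
  GK-trisection of genus `≥ 3` that is NOT weakly reducible (no disjoint non-separating pair
  `c, c′`), admitting no diffeomorphism to `S⁴`.  No refutation short of `¬ SmoothPoincare4`.
* (c) `minimalWeaklyReducible_iff` — the `let`-bound weak-reducibility clause factored as
  `WR M T` (`Iff.rfl`): the clause does not mention `g`, `k` or `e`.
* (d) RUNG `g = 3` RESTATES THE FRONTIER: `minimalWeaklyReducibleAt_three_iff` — modulo the
  route's own support `GenusThreeBase` (= Aranda–Zupan 2025 Thm 1.3, vendored as
  `az2025_weaklyReducible_genusThree_homotopySphere_gk`), K1 restricted to genus 3 is EQUIVALENT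
  to "no smooth homotopy 4-sphere has a minimal GK-trisection of genus 3", i.e. to the first open
  type (3;1,1,1) of `LowGenusTrisectionBarrier` itself: at the first rung the weak-reduction
  vocabulary buys nothing; new content starts at `g ≥ 4` (where K2 takes over).
* (e) THRESHOLD: `minimalWeaklyReducible_iff_ge_one` — modulo the support `LowGenusBase`
  (MZ17/MSZ16, tree fact `mz_genus_le_two_homotopySphere_gk`) the hypothesis `3 ≤ g` may be
  lowered to `1 ≤ g` (rungs 1, 2 are vacuous); it may NOT be lowered to `0 ≤ g`: the round `S⁴`
  with its minimal genus-`0` trisection has central surface `F = S²`, on which every smoothly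
  embedded circle separates (Jordan–Schoenflies), so `NonSep` fails — paper witness, not
  formalised (no Jordan curve theorem on `S²` in Mathlib).
* (f) NOT DECORATION: `wr_false_without_trisection` — dropping the hypothesis
  `IsGKTrisection M g k T` (keeping every binder, `e`, `3 ≤ g` and even minimality-free) the
  conclusion is FALSE: `M = S⁴`, `T = fun _ ↦ ∅` has empty central surface, and a curve is the
  range of a map from the (nonempty) circle.  Any proof must use the trisection hypothesis.

Paper findings (not formalisable here, recorded for the prover / planner):

* FAITHFULNESS.  arXiv:2503.04607 p. 2 L13–15: "T is weakly reducible if there are disjoint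
  non-separating curves c and c′ such that c bounds a disk in one of the three handlebodies, and
  c′ bounds a disk in the other two"; p. 6 L15–17 (fixed labels `H_α` / `H_β, H_γ`, the word
  "disjoint" dropped there but present on p. 2 and in every use, e.g. Fig. 3 caption L19–21);
  Remark 2.5 (why non-separating).  The decl's `WeaklyReducible` is the p. 2 form symmetrised
  over the label `p` (harmless: the crux quantifies over all labelled `T`, and
  `IsGKTrisection.comp_perm`).  `BoundsDisc` = properly embedded smooth disc (`range d ∩ F = c`,
  `(𝓡∂ 2).boundary` of the closed unit disc = unit circle by `boundary_closedBall`); `NonSep c`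
  = `IsConnected (F ∖ c)` ⇒ essential; no junk operators; quantifier order = informal text.
* SEMANTIC CONSEQUENCE the prover must know: the witnessing label `p` needs `k p ≥ 1` — `c′`
  non-separating and compressing in both `H q`, `H r` (`q, r ≠ p`) gives a NON-SEPARATING 2-sphere
  in `∂X_p ≅ #^{k_p}(S¹ × S²)`.  Hence NO `(g; 0,0,0)`-trisection is weakly reducible in this
  (= AZ's) sense; for homotopy spheres `g = k₀+k₁+k₂` (χ = 2) so `g ≥ 3` supplies such a `p`, and
  a minimal genus-3 one has type (3;1,1,1) (`Literature.Barriers.SmoothPoincare4`).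
* MUTATION.  Drop `e : M ≃ₕ S⁴`: FALSE in kind at every genus for the trivial `k = 0` reason —
  `CP²` (1;0,0,0), `#³CP²` (3;0,0,0), K3 (22;0,0,0) (Spreer–Tillmann 2018, trisection genus of
  K3 = 22 = b₂) are minimal and not weakly reducible; so the route's soft-kill (i) ("a strongly
  irreducible minimal trisection of a closed simply connected X with g = b₂ + Σkᵢ in print") is met
  trivially whenever `k = 0` and should be re-posed with `some k_p ≥ 1`, whose hypothesis class
  (simply connected, minimal genus > b₂) is again known to be inhabited only by exotic spheres —
  the crux has NO testable analogue class with π₁ = 1.  Drop minimality: open (contains AZ25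
  Question 8.3 / non-standard trisections of `S⁴`, p. 27).  Drop `3 ≤ g`: see (e).
* TRIVIALITY probes (T.lean in the seat folder): `exact?`, `simp`, `aesop` fail on the crux and on
  `MinimalWeaklyReducible → SmoothPoincare4` (`C → S` not available: K1 alone is silent on what a
  weakly reducible minimal trisection yields; only `K1 ∧ K2 ∧ supports → S`, the route's `closes`).
-/

open scoped Manifold ContDiff Topology ContinuousMap
open Set

namespace Summit.SmoothPoincare4.SmoothPoincare4.Cruxes.MinimalWeaklyReducible.BirthAttack

set_option linter.dupNamespace false

open Literature.Topology.FourManifolds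
open Summit.SmoothPoincare4.SmoothPoincare4.Theses.WeakReductionDescent

/-- The round `4`-sphere of Mathlib. -/
local notation "𝕊⁴" => (Metric.sphere (0 : EuclideanSpace ℝ (Fin 5)) 1)

/-! ### (c) The weak-reducibility clause, factored -/

/-- The `let`-bound conclusion of the crux, verbatim, as a predicate of the ambient manifold `M`
and the sectors `T` (it mentions neither `g`, `k` nor `e`). [folklore] -/
def WR (M : Type) [TopologicalSpace M] [ChartedSpace (EuclideanSpace ℝ (Fin 4)) M]
    (T : Fin 3 → Set M) : Prop :=
  (let F : Set M := ⋂ l, T l; let H : Fin 3 → Set M := fun p => ⋂ (l : Fin 3) (_ : l ≠ p), T l; let IsCurve : Set M → Prop := fun c => c ⊆ F ∧ ∃ γ : (Metric.sphere (0 : EuclideanSpace ℝ (Fin 2)) 1) → M, Manifold.IsSmoothEmbedding (𝓡 1) (𝓡 4) ((⊤ : ℕ∞) : WithTop ℕ∞) γ ∧ Set.range γ = c; let BoundsDisc : Set M → Set M → Prop := fun A c => ∃ d : (Metric.closedBall (0 : EuclideanSpace ℝ (Fin 2)) 1) → M, Manifold.IsSmoothEmbedding (𝓡∂ 2) (𝓡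 4) ((⊤ : ℕ∞) : WithTop ℕ∞) d ∧ Set.range d ⊆ A ∧ d '' ((𝓡∂ 2).boundary (Metric.closedBall (0 : EuclideanSpace ℝ (Fin 2)) 1)) = c ∧ Set.range d ∩ F = c; let NonSep : Set M → Prop := fun c => IsConnected (F \ c); let WeaklyReducible : Prop := ∃ (p : Fin 3) (c c' : Set M), IsCurve c ∧ IsCurve c' ∧ Disjoint c c' ∧ NonSep c ∧ NonSep c' ∧ BoundsDisc (H p) c ∧ ∀ q : Fin 3, q ≠ p → BoundsDisc (H q) c'; WeaklyReducible)

/-- "`T` is of minimal genus `g` among the GK-trisections of `M`" — the crux's minimality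
hypothesis, factored. [folklore] -/
def IsMinimalGenus (M : Type) [TopologicalSpace M] [ChartedSpace (EuclideanSpace ℝ (Fin 4)) M]
    (g : ℕ) : Prop :=
  ∀ (g' : ℕ) (k' : Fin 3 → ℕ) (T' : Fin 3 → Set M), IsGKTrisection M g' k' T' → g ≤ g'

/-- The crux, read back through the factorisation — `Iff.rfl`, so `WR` / `IsMinimalGenus` ARE the
decl's clauses. [folklore] -/
theorem minimalWeaklyReducible_iff :
    MinimalWeaklyReducible ↔
      ∀ (M : Type) [TopologicalSpace M] [T2Space M] [SecondCountableTopology M]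
        [ChartedSpace (EuclideanSpace ℝ (Fin 4)) M] [IsManifold (𝓡 4) ∞ M],
        (M ≃ₕ 𝕊⁴) → ∀ (g : ℕ) (k : Fin 3 → ℕ) (T : Fin 3 → Set M),
          IsGKTrisection M g k T → 3 ≤ g → IsMinimalGenus M g → WR M T :=
  Iff.rfl

/-- K1 restricted to one genus `g₀`. [folklore] -/
def MinimalWeaklyReducibleAt (g₀ : ℕ) : Prop :=
  ∀ (M : Type) [TopologicalSpace M] [T2Space M] [SecondCountableTopology M]
    [ChartedSpace (EuclideanSpace ℝ (Fin 4)) M] [IsManifold (𝓡 4) ∞ M],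
    (M ≃ₕ 𝕊⁴) → ∀ (k : Fin 3 → ℕ) (T : Fin 3 → Set M),
      IsGKTrisection M g₀ k T → IsMinimalGenus M g₀ → WR M T

/-- "No smooth homotopy 4-sphere (bare binders) has a minimal GK-trisection of genus `g₀`." For
`g₀ = 3` this is the first open type (3;1,1,1) of `LowGenusTrisectionBarrier`. [folklore] -/
def NoMinimalGenus (g₀ : ℕ) : Prop :=
  ∀ (M : Type) [TopologicalSpace M] [T2Space M] [SecondCountableTopology M]
    [ChartedSpace (EuclideanSpace ℝ (Fin 4)) M] [IsManifold (𝓡 4) ∞ M],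
    (M ≃ₕ 𝕊⁴) → ∀ (k : Fin 3 → ℕ) (T : Fin 3 → Set M),
      IsGKTrisection M g₀ k T → ¬ IsMinimalGenus M g₀

/-- The crux is the conjunction of its rungs `g₀ ≥ 3`. [folklore] -/
theorem minimalWeaklyReducible_iff_forall_at :
    MinimalWeaklyReducible ↔ ∀ g₀, 3 ≤ g₀ → MinimalWeaklyReducibleAt g₀ := by
  constructor
  · intro h g₀ hg₀ M _ _ _ _ _ e k T hT hmin
    exact h M e g₀ k T hT hg₀ hmin
  · intro h M _ _ _ _ _ e g k T hT hg hmin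
    exact h g hg M e k T hT hmin

/-- A rung with no instances holds vacuously. [folklore] -/
theorem minimalWeaklyReducibleAt_of_noMinimalGenus {g₀ : ℕ} (h : NoMinimalGenus g₀) :
    MinimalWeaklyReducibleAt g₀ := by
  intro M _ _ _ _ _ e k T hT hmin
  exact absurd hmin (h M e k T hT)

/-! ### (a) The shield `S → C` -/

variable {M : Type} [TopologicalSpace M] [ChartedSpace (EuclideanSpace ℝ (Fin 4)) M]
  [IsManifold (𝓡 4) ∞ M]

/-- A diffeomorphism to the round sphere pulls GK's genus-`0` trisection of `S⁴` back to a
genus-`0` GK-trisection of `M` (as in the sibling workfile). [folklore] -/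
theorem exists_gkTrisection_genus_zero_of_diffeomorph (Φ : M ≃ₘ⟮𝓡 4, 𝓡 4⟯ 𝕊⁴) :
    ∃ T : Fin 3 → Set M, IsGKTrisection M 0 (fun _ => 0) T := by
  obtain ⟨S₀, hS₀⟩ := sphere_genusZero_gkTrisection_holds
  exact ⟨fun i => Φ.symm '' S₀ i, hS₀.isGKTrisection.image_diffeomorph' Φ.symm⟩

/-- If `M` is diffeomorphic to `S⁴`, no genus `g ≥ 1` is the minimal trisection genus of `M`.
[folklore] -/
theorem not_isMinimalGenus_of_diffeomorph (Φ : M ≃ₘ⟮𝓡 4, 𝓡 4⟯ 𝕊⁴) {g : ℕ} (hg : 1 ≤ g) :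
    ¬ IsMinimalGenus M g := by
  intro hmin
  obtain ⟨T₀, hT₀⟩ := exists_gkTrisection_genus_zero_of_diffeomorph Φ
  have := hmin 0 (fun _ => 0) T₀ hT₀
  omega

/-- Under the summit every rung `g₀ ≥ 1` is empty. [folklore] -/
theorem noMinimalGenus_of_spc4 (h : _root_.SmoothPoincare4) {g₀ : ℕ} (hg₀ : 1 ≤ g₀) :
    NoMinimalGenus g₀ := by
  intro M _ _ _ _ _ e k T _hT
  obtain ⟨Φ⟩ := h M ‹_› ‹_› e
  exact not_isMinimalGenus_of_diffeomorph Φ hg₀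

/-- **The crux is implied by the summit** (`S → C`, shield): `SmoothPoincare4 → MinimalWeaklyReducible`,
by vacuity of `3 ≤ g ∧ minimal`. [folklore] -/
theorem minimalWeaklyReducible_of_spc4 (h : _root_.SmoothPoincare4) : MinimalWeaklyReducible :=
  minimalWeaklyReducible_iff_forall_at.2 fun _g₀ hg₀ =>
    minimalWeaklyReducibleAt_of_noMinimalGenus (noMinimalGenus_of_spc4 h (by omega))

/-! ### (b) Kill criterion -/

/-- A refutation of the crux refutes the summit. [folklore] -/
theorem not_spc4_of_not_minimalWeaklyReducible (h : ¬ MinimalWeaklyReducible) :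
    ¬ _root_.SmoothPoincare4 :=
  fun hs => h (minimalWeaklyReducible_of_spc4 hs)

/-- **What a kill would be**: a smooth homotopy 4-sphere `M` carrying a minimal GK-trisection `T`
of genus `≥ 3` that is NOT weakly reducible (`¬ WR M T`: no disjoint non-separating pair `c, c′`
with `c` compressing in one handlebody and `c′` in the other two — a strongly irreducible
minimal trisection), and admitting no diffeomorphism to the round `S⁴`. [folklore] -/
theorem exotic_of_not_minimalWeaklyReducible (h : ¬ MinimalWeaklyReducible) :
    ∃ (M : Type) (_ : TopologicalSpace M) (_ : T2Space M) (_ : SecondCountableTopology M)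
      (_ : ChartedSpace (EuclideanSpace ℝ (Fin 4)) M) (_ : IsManifold (𝓡 4) ∞ M),
      Nonempty (M ≃ₕ 𝕊⁴) ∧
      (∃ (g : ℕ) (k : Fin 3 → ℕ) (T : Fin 3 → Set M), IsGKTrisection M g k T ∧ 3 ≤ g ∧
        IsMinimalGenus M g ∧ ¬ WR M T) ∧
      IsEmpty (M ≃ₘ⟮𝓡 4, 𝓡 4⟯ 𝕊⁴) := by
  rw [minimalWeaklyReducible_iff] at h
  push Not at h
  obtain ⟨M, _, _, _, _, _, e, g, k, T, hT, hg, hmin, hwr⟩ := h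
  have h1 : 1 ≤ g := le_trans (by norm_num) hg
  exact ⟨M, ‹_›, ‹_›, ‹_›, ‹_›, ‹_›, ⟨e⟩, ⟨g, k, T, hT, hg, hmin, hwr⟩,
    ⟨fun Φ => not_isMinimalGenus_of_diffeomorph Φ h1 hmin⟩⟩

/-! ### (d) Rung `g = 3` restates the (3;1,1,1) frontier -/

/-- K1 at genus 3 together with the route's support `GenusThreeBase` (AZ25 Thm 1.3 for homotopy
spheres) empties the rung: a weakly reducible genus-3 trisection makes `M ≅ S⁴`, whose genus-`0`
trisection contradicts minimality. [folklore] -/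
theorem noMinimalGenus_three_of (h1 : MinimalWeaklyReducibleAt 3) (h4 : GenusThreeBase) :
    NoMinimalGenus 3 := by
  intro M _ _ _ _ _ e k T hT hmin
  have hwr : WR M T := h1 M e k T hT hmin
  obtain ⟨Φ⟩ := h4 M e k T hT hwr
  exact not_isMinimalGenus_of_diffeomorph Φ (by norm_num) hmin

/-- **Rung 3 ≡ frontier.** Modulo `GenusThreeBase`, K1 restricted to genus 3 is EQUIVALENT to "no
smooth homotopy 4-sphere has minimal GK-trisection genus 3" — the (3;1,1,1) case of SPC4-by-genus
(`LowGenusTrisectionBarrier`'s first open type); weak reduction adds no leverage at this rung.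
[folklore] -/
theorem minimalWeaklyReducibleAt_three_iff (h4 : GenusThreeBase) :
    MinimalWeaklyReducibleAt 3 ↔ NoMinimalGenus 3 :=
  ⟨fun h1 => noMinimalGenus_three_of h1 h4, minimalWeaklyReducibleAt_of_noMinimalGenus⟩

/-! ### (e) The threshold `3 ≤ g` -/

/-- Modulo the support `LowGenusBase` (MZ17 / MSZ16), rungs 1 and 2 are empty. [folklore] -/
theorem noMinimalGenus_of_lowGenusBase (h5 : LowGenusBase) {g₀ : ℕ} (h1 : 1 ≤ g₀) (h2 : g₀ ≤ 2) :
    NoMinimalGenus g₀ := by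
  intro M _ _ _ _ _ e k T hT
  obtain ⟨Φ⟩ := h5 M e g₀ k T hT h2
  exact not_isMinimalGenus_of_diffeomorph Φ h1

/-- **Threshold.** Modulo `LowGenusBase` the crux is equivalent to its version with `1 ≤ g` in
place of `3 ≤ g` (the threshold is cosmetic above 1).  It is NOT equivalent to the `0 ≤ g`
version, which fails at the round `S⁴` (genus-`0` minimal trisection, `F = S²` has no
non-separating circle — Jordan–Schoenflies; paper witness). [folklore] -/
theorem minimalWeaklyReducible_iff_ge_one (h5 : LowGenusBase) :
    MinimalWeaklyReducible ↔ ∀ g₀, 1 ≤ g₀ → MinimalWeaklyReducibleAt g₀ := by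
  rw [minimalWeaklyReducible_iff_forall_at]
  constructor
  · intro h g₀ hg₀
    rcases Nat.lt_or_ge g₀ 3 with hlt | hge
    · exact minimalWeaklyReducibleAt_of_noMinimalGenus
        (noMinimalGenus_of_lowGenusBase h5 hg₀ (by omega))
    · exact h g₀ hge
  · intro h g₀ hg₀
    exact h g₀ (by omega)

/-! ### (f) The trisection hypothesis is load-bearing (conclusion is not decoration) -/

/-- With empty sectors the weak-reducibility clause fails: the central surface is empty while a
curve is the range of a map from the nonempty circle. [folklore] -/
theorem not_wr_empty (M : Type) [TopologicalSpace M] [ChartedSpace (EuclideanSpace ℝ (Fin 4)) M] :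
    ¬ WR M (fun _ => (∅ : Set M)) := by
  rintro ⟨p, c, c', ⟨hcF, γ, -, hγ⟩, -⟩
  have hF : (⋂ l : Fin 3, (fun _ : Fin 3 => (∅ : Set M)) l) = ∅ := by
    simpa using (iInter_const (ι := Fin 3) (s := (∅ : Set M)))
  have hc : c = ∅ := subset_empty_iff.mp (hF ▸ hcF)
  obtain ⟨x, hx⟩ := (NormedSpace.sphere_nonempty (x := (0 : EuclideanSpace ℝ (Fin 2)))
    (r := 1)).mpr zero_le_one
  have : γ ⟨x, hx⟩ ∈ c := hγ ▸ mem_range_self _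
  simp [hc] at this

/-- **`_false_without_` the trisection hypothesis.** Dropping `IsGKTrisection M g k T` (and
minimality with it) from the crux — keeping the bare binders, `e : M ≃ₕ S⁴` and `3 ≤ g` — gives a
FALSE statement: witness the round `S⁴` itself with empty sectors.  Any proof of K1 must use the
trisection hypothesis. [folklore] -/
theorem wr_false_without_trisection :
    ¬ ∀ (M : Type) [TopologicalSpace M] [T2Space M] [SecondCountableTopology M]
        [ChartedSpace (EuclideanSpace ℝ (Fin 4)) M] [IsManifold (𝓡 4) ∞ M],
        (M ≃ₕ 𝕊⁴) → ∀ (g : ℕ) (_k : Fin 3 → ℕ) (T : Fin 3 → Set M), 3 ≤ g → WR M T := by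
  intro h
  exact not_wr_empty 𝕊⁴ (h 𝕊⁴ (ContinuousMap.HomotopyEquiv.refl 𝕊⁴) 3 (fun _ => 1)
    (fun _ => ∅) le_rfl)

end Summit.SmoothPoincare4.SmoothPoincare4.Cruxes.MinimalWeaklyReducible.BirthAttack
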